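import Mathlib.Geometry.Manifold.MFDeriv.Atlas
import Mathlib.Analysis.Calculus.LocalExtr.Basic
import HarnessLib

/-!
# Fermat's theorem on manifolds: the differential vanishes at a local extremum

Mathlib has Fermat's theorem for maps on normed spaces (`IsLocalMin.fderiv_eq_zero`,
`IsLocalExtr.fderiv_eq_zero`, `Mathlib/Analysis/Calculus/LocalExtr/Basic.lean`) but not its manifold
form.  For a real function `f` on a manifold modelled on a BOUNDARYLESS model with corners, a local
extremum `x` of `f` has `mfderiv I 𝓘(ℝ, ℝ) f x = 0`; contrapositively, a point with non-zero differential
has, in every neighbourhood, points where `f` is strictly smaller and points where it is strictly larger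
(used to see that a regular level `{f = c}` is approached from the strict sub-level side `{f < c}` —
crux `NonTrappingHawkingRigidity` of the summit `FinalStateConjecture`, line `Sketch`, stub
`stub_slabPatching`).

* `IsLocalExtr.mfderiv_eq_zero`, `IsLocalMin.mfderiv_eq_zero`, `IsLocalMax.mfderiv_eq_zero`;
* `exists_lt_of_mfderiv_ne_zero`, `exists_gt_of_mfderiv_ne_zero`.

Everything is proved; no definitions, no named facts.

## References

* Mathlib, `Mathlib/Analysis/Calculus/LocalExtr/Basic.lean` (Fermat's theorem in normed spaces);
  J. M. Lee, *Introduction to Smooth Manifolds*, 2nd ed., Prop. 5.49 / Exercise 8-? (critical points).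
  [folklore]
-/

open Set Filter
open scoped Manifold Topology

namespace Literature.Geometry.Manifold

variable {E : Type*} [NormedAddCommGroup E] [NormedSpace ℝ E] {H : Type*} [TopologicalSpace H]
  {I : ModelWithCorners ℝ E H} [I.Boundaryless] {M : Type*} [TopologicalSpace M] [ChartedSpace H M]
  {f : M → ℝ} {x : M}

/-- **Fermat's theorem on a manifold (boundaryless model).**  At a local extremum `x` of `f : M → ℝ` the
differential vanishes: `mfderiv I 𝓘(ℝ, ℝ) f x = 0`.  Proof: `mfderiv` is the Fréchet derivative of
`f ∘ (extChartAt I x)⁻¹` at `extChartAt I x x` (within `range I = univ`), and that composite has a local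
extremum there because the extended chart is an open map around `x`; if `f` is not differentiable at `x`
the junk value of `mfderiv` is `0` anyway. [folklore] -/
theorem _root_.IsLocalExtr.mfderiv_eq_zero (h : IsLocalExtr f x) : mfderiv I 𝓘(ℝ, ℝ) f x = 0 := by
  by_cases hf : MDifferentiableAt I 𝓘(ℝ, ℝ) f x
  · -- the composite with the inverse extended chart has a local extremum at `extChartAt I x x`
    have hsymm : ContinuousAt (extChartAt I x).symm (extChartAt I x x) := continuousAt_extChartAt_symm x
    have hcomp : IsLocalExtr (f ∘ (extChartAt I x).symm) (extChartAt I x x) := by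
      have h' : IsLocalExtr f ((extChartAt I x).symm (extChartAt I x x)) := by
        rw [extChartAt_to_inv]; exact h
      exact IsLocalExtr.comp_continuous h' hsymm
    have hzero : fderiv ℝ (f ∘ (extChartAt I x).symm) (extChartAt I x x) = 0 := hcomp.fderiv_eq_zero
    rw [hf.mfderiv]
    simp only [writtenInExtChartAt, extChartAt_model_space_eq_id, PartialEquiv.refl_coe,
      Function.id_comp, ModelWithCorners.Boundaryless.range_eq_univ, fderivWithin_univ]
    exact hzero
  · exact mfderiv_zero_of_not_mdifferentiableAt hf

/-- Fermat's theorem on a manifold, local-minimum form. [folklore] -/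
theorem _root_.IsLocalMin.mfderiv_eq_zero (h : IsLocalMin f x) : mfderiv I 𝓘(ℝ, ℝ) f x = 0 :=
  IsLocalExtr.mfderiv_eq_zero h.isExtr

/-- Fermat's theorem on a manifold, local-maximum form. [folklore] -/
theorem _root_.IsLocalMax.mfderiv_eq_zero (h : IsLocalMax f x) : mfderiv I 𝓘(ℝ, ℝ) f x = 0 :=
  IsLocalExtr.mfderiv_eq_zero h.isExtr

/-- **A point with non-zero differential is approached by strictly smaller values**: if
`mfderiv I 𝓘(ℝ, ℝ) f x ≠ 0` then every neighbourhood of `x` contains a point `y` with `f y < f x`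
(contrapositive of Fermat: otherwise `x` is a local minimum). [folklore] -/
theorem exists_lt_of_mfderiv_ne_zero (h : mfderiv I 𝓘(ℝ, ℝ) f x ≠ 0) {U : Set M} (hU : U ∈ 𝓝 x) :
    ∃ y ∈ U, f y < f x := by
  by_contra hcon
  simp only [not_exists, not_and, not_lt] at hcon
  have hmin : IsLocalMin f x := Filter.mem_of_superset hU fun y hy ↦ hcon y hy
  exact h hmin.mfderiv_eq_zero

/-- **A point with non-zero differential is approached by strictly larger values.** [folklore] -/
theorem exists_gt_of_mfderiv_ne_zero (h : mfderiv I 𝓘(ℝ, ℝ) f x ≠ 0) {U : Set M} (hU : U ∈ 𝓝 x) :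
    ∃ y ∈ U, f x < f y := by
  by_contra hcon
  simp only [not_exists, not_and, not_lt] at hcon
  have hmax : IsLocalMax f x := Filter.mem_of_superset hU fun y hy ↦ hcon y hy
  exact h hmax.mfderiv_eq_zero

end Literature.Geometry.Manifold
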